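import Summits.AtomisticToContinuum.HydrodynamicLimit.Theses.JParityClosure
import Summits.AtomisticToContinuum.HydrodynamicLimit.Theorems.DensityCap.Negative.DensityCapFalseOfDenseExcursionAbovePacking
import HarnessLib

/-!
# `ParityBandClosure` (crux 7, stmt-AtomisticToContinuum-17608), negative side: ANATOMY OF A REFUTATION

Standing disprover's lemmas (`Cruxes/ParityBandClosure/Disproof.lean` §1–§3,
refuter-cdisprove-stmt-AtomisticToContinuum-17608-0, cycle 1). The crux is the closed-`Prop` implication
`OddContactSymmetry → EvenStressEnskog → RateFloor → LocalSecondLaw → DensityCap → _root_.HydrodynamicLimit`, so: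

* `not_parityBandClosure_iff` — a refutation is EXACTLY a proof of the five physics cruxes together with a
  refutation of the (packing-guarded) summit conjunct; in particular `not_hydrodynamicLimit_of_not_parityBandClosure`.
* `not_parityBandClosure_without_*_iff` — dropping any one of the five outer hypotheses gives a statement whose
  negation is `(the other four) ∧ ¬ Statement`: every "`_false_without_H`" lemma for this crux is summit-hard
  (it refutes the conjunct from four cruxes), so none can exist on the negative side short of the open problem.
* `packingBandAt_of_not_parityBandClosure` — any refutation certifies, through the UNGUARDED hypothesis `DensityCap`
  and the tree's `DensityCapNegative.packingBandAt_of_densityCap`, the sure packing band `ρ_t(x) σ³ ≤ 81/π` for every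
  tied classical hs-Euler solution at small `σ`; contrapositively (`Disproof.lean` §3) a failure of that band makes the
  crux vacuously TRUE while killing the route through `DensityCap`.

Pure propositional bookkeeping over the route file and one landed negative lemma; no new definitions.
-/

namespace Summit.AtomisticToContinuum.HydrodynamicLimit.Theorems

namespace ParityBandClosureNegative

open Summit.AtomisticToContinuum.HydrodynamicLimit.Theses.JParityClosure
open DensityCapNegative (PackingBandAt packingBandAt_of_densityCap)

/-- **What a kill must contain.** `¬ ParityBandClosure` is equivalent to: all five physics cruxes of route
JParityClosure hold AND the packing-guarded summit conjunct `_root_.HydrodynamicLimit` fails. -/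
theorem not_parityBandClosure_iff :
    ¬ ParityBandClosure ↔ (OddContactSymmetry ∧ EvenStressEnskog ∧ RateFloor ∧ LocalSecondLaw ∧ DensityCap) ∧
      ¬ _root_.HydrodynamicLimit := by
  unfold ParityBandClosure
  constructor
  · intro h
    by_contra hc
    exact h fun h₂ h₃ h₄ h₅ h₆ => by_contra fun hS => hc ⟨⟨h₂, h₃, h₄, h₅, h₆⟩, hS⟩
  · rintro ⟨⟨h₂, h₃, h₄, h₅, h₆⟩, hS⟩ h
    exact hS (h h₂ h₃ h₄ h₅ h₆)

/-- Any refutation of the closure crux refutes the summit conjunct. -/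
theorem not_hydrodynamicLimit_of_not_parityBandClosure (h : ¬ ParityBandClosure) : ¬ _root_.HydrodynamicLimit :=
  (not_parityBandClosure_iff.1 h).2

/-- Any refutation of the closure crux proves the five physics cruxes (the route's whole positive programme). -/
theorem cruxes_of_not_parityBandClosure (h : ¬ ParityBandClosure) :
    OddContactSymmetry ∧ EvenStressEnskog ∧ RateFloor ∧ LocalSecondLaw ∧ DensityCap :=
  (not_parityBandClosure_iff.1 h).1

/-- LOAD-BEARING ANALYSIS, `OddContactSymmetry` dropped: the negation is `(other four) ∧ ¬ Statement`. -/
theorem not_parityBandClosure_without_odd_iff :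
    ¬ (EvenStressEnskog → RateFloor → LocalSecondLaw → DensityCap → _root_.HydrodynamicLimit) ↔
      (EvenStressEnskog ∧ RateFloor ∧ LocalSecondLaw ∧ DensityCap) ∧ ¬ _root_.HydrodynamicLimit := by
  constructor
  · intro h
    by_contra hc
    exact h fun h₃ h₄ h₅ h₆ => by_contra fun hS => hc ⟨⟨h₃, h₄, h₅, h₆⟩, hS⟩
  · rintro ⟨⟨h₃, h₄, h₅, h₆⟩, hS⟩ h
    exact hS (h h₃ h₄ h₅ h₆)

/-- LOAD-BEARING ANALYSIS, `EvenStressEnskog` dropped. -/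
theorem not_parityBandClosure_without_even_iff :
    ¬ (OddContactSymmetry → RateFloor → LocalSecondLaw → DensityCap → _root_.HydrodynamicLimit) ↔
      (OddContactSymmetry ∧ RateFloor ∧ LocalSecondLaw ∧ DensityCap) ∧ ¬ _root_.HydrodynamicLimit := by
  constructor
  · intro h
    by_contra hc
    exact h fun h₂ h₄ h₅ h₆ => by_contra fun hS => hc ⟨⟨h₂, h₄, h₅, h₆⟩, hS⟩
  · rintro ⟨⟨h₂, h₄, h₅, h₆⟩, hS⟩ h
    exact hS (h h₂ h₄ h₅ h₆)

/-- LOAD-BEARING ANALYSIS, `RateFloor` dropped. -/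
theorem not_parityBandClosure_without_rate_iff :
    ¬ (OddContactSymmetry → EvenStressEnskog → LocalSecondLaw → DensityCap → _root_.HydrodynamicLimit) ↔
      (OddContactSymmetry ∧ EvenStressEnskog ∧ LocalSecondLaw ∧ DensityCap) ∧ ¬ _root_.HydrodynamicLimit := by
  constructor
  · intro h
    by_contra hc
    exact h fun h₂ h₃ h₅ h₆ => by_contra fun hS => hc ⟨⟨h₂, h₃, h₅, h₆⟩, hS⟩
  · rintro ⟨⟨h₂, h₃, h₅, h₆⟩, hS⟩ h
    exact hS (h h₂ h₃ h₅ h₆)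

/-- LOAD-BEARING ANALYSIS, `LocalSecondLaw` dropped. -/
theorem not_parityBandClosure_without_lsl_iff :
    ¬ (OddContactSymmetry → EvenStressEnskog → RateFloor → DensityCap → _root_.HydrodynamicLimit) ↔
      (OddContactSymmetry ∧ EvenStressEnskog ∧ RateFloor ∧ DensityCap) ∧ ¬ _root_.HydrodynamicLimit := by
  constructor
  · intro h
    by_contra hc
    exact h fun h₂ h₃ h₄ h₆ => by_contra fun hS => hc ⟨⟨h₂, h₃, h₄, h₆⟩, hS⟩
  · rintro ⟨⟨h₂, h₃, h₄, h₆⟩, hS⟩ h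
    exact hS (h h₂ h₃ h₄ h₆)

/-- LOAD-BEARING ANALYSIS, `DensityCap` dropped. -/
theorem not_parityBandClosure_without_dc_iff :
    ¬ (OddContactSymmetry → EvenStressEnskog → RateFloor → LocalSecondLaw → _root_.HydrodynamicLimit) ↔
      (OddContactSymmetry ∧ EvenStressEnskog ∧ RateFloor ∧ LocalSecondLaw) ∧ ¬ _root_.HydrodynamicLimit := by
  constructor
  · intro h
    by_contra hc
    exact h fun h₂ h₃ h₄ h₅ => by_contra fun hS => hc ⟨⟨h₂, h₃, h₄, h₅⟩, hS⟩
  · rintro ⟨⟨h₂, h₃, h₄, h₅⟩, hS⟩ h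
    exact hS (h h₂ h₃ h₄ h₅)

/-- **Any refutation of the crux certifies the packing band at level `81/π`.** It contains a proof of the
UNGUARDED `DensityCap`, which forces `ρ_t(x) σ³ ≤ 81/π` on every tied classical hard-sphere-Euler solution at small
`σ` (`DensityCapNegative.packingBandAt_of_densityCap`). Contrapositively, an implosion of the typed equation of state
past the sure packing level at arbitrarily small `σ` makes the crux vacuously true and kills the route through
`DensityCap` — the one vacuity channel of this crux with a named trigger (`DenseExcursionAbovePacking`). -/
theorem packingBandAt_of_not_parityBandClosure (h : ¬ ParityBandClosure) : PackingBandAt (81 / Real.pi) :=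
  packingBandAt_of_densityCap (cruxes_of_not_parityBandClosure h).2.2.2.2

end ParityBandClosureNegative

end Summit.AtomisticToContinuum.HydrodynamicLimit.Theorems
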